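import Summits.ResolutionOfSingularities.ResolutionOfSingularities.Theorems.FrobeniusClosingPatchingRelPerfectTwoPlanesLevelTwo
import Summits.ResolutionOfSingularities.ResolutionOfSingularities.Theorems.FrobeniusClosingPatchingRelPerfectTwoPlanesLevelTwoS
import Summits.ResolutionOfSingularities.ResolutionOfSingularities.Theorems.FrobeniusClosingPatchingRelPerfectLetterTowerTwoAny
import HarnessLib

/-!
# Crux `PatchingRelPerfect` (stmt-ResolutionOfSingularities-16161), chain w52 — the rank-two member
# `f = x₀x₁ + x₂³`: the `t`-chart of the plane blow-up in the UNIT case `y = 1` (chart `B₁`)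

[OURS · L1 W5.2 · rung, piece R2 of the design note NEXT-two-planes-cube.md, Add. 11–12]
`…TwoPlanesLevelTwo` resolves the `t`-chart `C` of `Bl_{(u,e₀)} Spec A` by the letter flag
`(c, t)(c, t w)(c, t w t)`, `c = ψ y + t ψ z`, under hypotheses that fail when `y` is a unit
(`A/(y)` a domain, …) — the situation of the chart `B₁` of `Bl_𝔪`, where `y = e₁ = x₁/x₁ = 1`.
There `c = 1 + t ψ z ≡ 1 (mod t)`, so `(c, t) = (1)` and `(c, w t) = (c, w t²) = (c, w)`: the
flag collapses to `(c, w)²`, a two-letter tower with repeats (`…LetterTowerTwoAny`), which needs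
only `(c, w)` quasi-regular and `C/(c, w) ≅ (A/(u,e₀))[X]/(1 + X z̄)` regular.  PROVED:

* `span_pair_mul_pow_eq_of_one_add` — `(c, w tᵏ) = (c, w)` when `c = 1 + t m` (any ring);
* `map_tpProd_t_one` — the image of the three companion factors is `(w)³ · (c, w)(c, w)`;
* `isRegular_of_isBlowup_tpProd_t_one` — **the `t`-chart is resolved in the unit case**, assuming
  `A`, `A/(u,e₀)` regular domains, `e₀ ∉ (u)` and `(A/(u,e₀))[X]/(1 + X z̄)` regular.

Arbitrary rings; nothing here is a statement of the manuscript under review.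

## References

* The Stacks Project, Tags 080A, 080B, 0804, 0BIQ. [StacksProject]
* Q. Liu, *Algebraic Geometry and Arithmetic Curves*, OUP 2002, Thm. 8.1.19 (a). [Liu2002]
-/

-- `Summit.<Summit>.<Sub>.Theorems` with `Sub = Summit` (single-conjunct summit, D-0017)
set_option linter.dupNamespace false

noncomputable section

open CategoryTheory CategoryTheory.Limits AlgebraicGeometry Literature.AlgebraicGeometry.Resolution
open IsLocalRing

namespace Summit.ResolutionOfSingularities.ResolutionOfSingularities.Theorems

namespace TwoPlanesRung

open ConeRung

universe u

/-- **`(c, w tᵏ) = (c, w)` when `c = 1 + t m`** (`w tʲ = w tʲ c − (w tʲ⁺¹) m`). [folklore] -/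
theorem span_pair_mul_pow_eq_of_one_add {R : Type*} [CommRing R] (c w t m : R)
    (hc : c = 1 + t * m) (k : ℕ) : Ideal.span {c, w * t ^ k} = Ideal.span {c, w} := by
  induction k with
  | zero => rw [pow_zero, mul_one]
  | succ k ih =>
    rw [← ih]
    apply le_antisymm
    · rw [Ideal.span_le]
      rintro b (rfl | rfl)
      · exact Ideal.subset_span (Set.mem_insert _ _)
      · rw [SetLike.mem_coe, pow_succ, ← mul_assoc]
        exact Ideal.mul_mem_right _ _ (Ideal.subset_span (Set.mem_insert_of_mem _ rfl))
    · rw [Ideal.span_le]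
      rintro b (rfl | rfl)
      · exact Ideal.subset_span (Set.mem_insert _ _)
      · have e : w * t ^ k = w * t ^ k * c - w * t ^ (k + 1) * m := by rw [hc]; ring
        rw [SetLike.mem_coe, e]
        exact Ideal.sub_mem _ (Ideal.mul_mem_left _ _ (Ideal.subset_span (Set.mem_insert _ _)))
          (Ideal.mul_mem_right _ _ (Ideal.subset_span (Set.mem_insert_of_mem _ rfl)))

/-- `(c, t) = (1)` when `c = 1 + t m`. [folklore] -/
theorem span_pair_eq_top_of_one_add {R : Type*} [CommRing R] (c t m : R) (hc : c = 1 + t * m) :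
    Ideal.span {c, t} = ⊤ := by
  rw [Ideal.eq_top_iff_one]
  have e : (1 : R) = c - t * m := by rw [hc]; ring
  rw [e]
  exact Ideal.sub_mem _ (Ideal.subset_span (Set.mem_insert _ _))
    (Ideal.mul_mem_right _ _ (Ideal.subset_span (Set.mem_insert_of_mem _ rfl)))

section TChartUnit

variable {A : Type u} [CommRing A] (uu e₀ y z : A)

local notation3 "cc" => (Fin.cons uu (fun _ : Fin 1 => e₀) : Fin 2 → A)
local notation3 "II" => Ideal.span (Set.range (Fin.cons uu (fun _ : Fin 1 => e₀) : Fin 2 → A))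
/-- the `e₀`-chart («`t`-chart») `C`, its structure map, exceptional parameter `w`, `t = u/e₀` -/
local notation3 "C" => chartRing cc (Fin.succ 0)
local notation3 "ψ" => chartBase cc (Fin.succ 0)
local notation3 "w" => chartBase cc (Fin.succ 0) (cc (Fin.succ 0))
local notation3 "tt" => chartGen cc (Fin.succ 0) 0
/-- the strict transform `c = ψ y + t ψ z` of `H = e₀ y + u z` -/
local notation3 "c♯" => chartBase cc (Fin.succ 0) y + chartGen cc (Fin.succ 0) 0 * chartBase cc (Fin.succ 0) z
/-- the polynomial model `(A/(u,e₀))[X]` of the exceptional divisor `C/(w)` and the image of `c` -/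
local notation3 "PP" => MvPolynomial {j : Fin 2 // j ≠ Fin.succ 0} (A ⧸ II)
local notation3 "g♭" => (MvPolynomial.C (Ideal.Quotient.mk II y) : MvPolynomial {j : Fin 2 // j ≠ Fin.succ 0} (A ⧸ II))
  + MvPolynomial.X (⟨0, (Fin.succ_ne_zero 0).symm⟩ : {j : Fin 2 // j ≠ Fin.succ 0}) *
    MvPolynomial.C (Ideal.Quotient.mk II z)

/-- In the unit case `c = 1 + t ψ z`. [folklore] -/
theorem c_eq_one_add (hy1 : y = 1) : c♯ = 1 + tt * ψ z := by
  rw [hy1, map_one]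

/-- **Unit case: the flag `(c,t)(c,tw)(c,twt)` is `(c,w)(c,w)`** (as the letter flag of the word
`(w, 1)`). [folklore] -/
theorem tp_flag_three_eq_two_of_one (hy1 : y = 1) :
    ∏ s ∈ Finset.range 3, Ideal.span {c♯, ∏ r ∈ Finset.range (s + 1), [tt, w, tt].getD r 1} =
      ∏ s ∈ Finset.range 2, Ideal.span {c♯, ∏ r ∈ Finset.range (s + 1), [w, 1].getD r 1} := by
  have hc := c_eq_one_add uu e₀ y z hy1
  have h1 : Ideal.span {c♯, tt} = ⊤ := span_pair_eq_top_of_one_add _ _ _ hc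
  have h2 : Ideal.span {c♯, tt * w} = Ideal.span {c♯, w} := by
    rw [show tt * w = w * tt ^ 1 by ring]
    exact span_pair_mul_pow_eq_of_one_add _ _ _ _ hc 1
  have h3 : Ideal.span {c♯, tt * w * tt} = Ideal.span {c♯, w} := by
    rw [show tt * w * tt = w * tt ^ 2 by ring]
    exact span_pair_mul_pow_eq_of_one_add _ _ _ _ hc 2
  have hmid : Ideal.span {c♯, tt} * Ideal.span {c♯, tt * w} * Ideal.span {c♯, tt * w * tt} =
      Ideal.span {c♯, w} * Ideal.span {c♯, w} := by
    rw [h1, h2, h3, ← Ideal.one_eq_top, one_mul]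
  exact (tp_flag_three _ _ _).trans (hmid.trans (tp_flag_two _ _).symm)

/-- **Unit case: the image of the three companion factors on the `t`-chart is
`(w)³ · (c, w)(c, w)`.** [cite: StacksProject, Tag 080B] -/
theorem map_tpProd_t_one (hy1 : y = 1) :
    (Ideal.span {e₀ * y, uu} *
        (Ideal.span {e₀ * y + uu * z} ⊔ Ideal.span {uu} * Ideal.span {e₀} ⊔ Ideal.span {uu} ^ 2) *
        (Ideal.span {e₀ * y + uu * z} ⊔ Ideal.span {uu} ^ 2)).map ψ =
      Ideal.span {w} ^ 3 * ∏ s ∈ Finset.range 2,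
        Ideal.span {c♯, ∏ r ∈ Finset.range (s + 1), [w, 1].getD r 1} := by
  rw [map_tpProd_t uu e₀ y z, tp_flag_three_eq_two_of_one uu e₀ y z hy1]

/-- `1 ∉ (u, e₀)` when `A/(u,e₀)` is a domain. [folklore] -/
theorem one_notMem_plane [IsDomain (A ⧸ II)] : (1 : A) ∉ II := fun h1 =>
  not_subsingleton (A ⧸ II) (Ideal.Quotient.subsingleton_iff.mpr ((Ideal.eq_top_iff_one _).mpr h1))

/-- **The `t`-chart of the plane blow-up in the unit case is resolved by the companion factors**:
every blowing up of `Spec C` along the image of `(e₀y, u)·((H) + u(e₀) + (u²))·((H) + (u²))`,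
`y = 1`, is regular (twist off `(w)³`, then the two-letter tower `(c, w)(c, w)`).
[cite: StacksProject, Tag 080A] [cite: StacksProject, Tag 080B] [cite: Liu2002, Thm. 8.1.19 (a)] -/
theorem isRegular_of_isBlowup_tpProd_t_one (hy1 : y = 1) (hc : IsQuasiRegular cc) [IsDomain A]
    [IsRegularRing A] [IsDomain (A ⧸ II)] [IsRegularRing (A ⧸ II)] (he : e₀ ∉ Ideal.span {uu})
    (hPr : IsRegularRing (PP ⧸ Ideal.span {g♭}))
    {Y : Scheme.{u}} {ρ : Y ⟶ Spec (.of C)}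
    (hρ : IsBlowup ρ (affineBlowup.idealSheaf ((Ideal.span {e₀ * y, uu} *
        (Ideal.span {e₀ * y + uu * z} ⊔ Ideal.span {uu} * Ideal.span {e₀} ⊔ Ideal.span {uu} ^ 2) *
        (Ideal.span {e₀ * y + uu * z} ⊔ Ideal.span {uu} ^ 2)).map ψ))) :
    Scheme.IsRegular Y := by
  haveI : IsRegularRing C := isRegularRing_blowupChart cc (Fin.succ 0) hc
  haveI : IsDomain C := isDomain_chart uu e₀ he
  have hy : y ∉ II := by rw [hy1]; exact one_notMem_plane uu e₀
  have hw3 : w ^ 3 ∈ nonZeroDivisors C := pow_mem (w_mem_nonZeroDivisors uu e₀) 3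
  have hcw := isWeaklyRegular_c_w uu e₀ y z hc hy he
  rw [map_tpProd_t_one uu e₀ y z hy1, Ideal.span_singleton_pow] at hρ
  exact CoreRungTower.isRegular_of_isBlowup_span_singleton_mul hw3 _
    (fun Y' ρ' h' => isRegular_of_isBlowup_letterTower_two'' 2 c♯ w (fun r => [w, 1].getD r 1)
      (tp_letters_spec_s w) (isQuasiRegular_of_isWeaklyRegular _ hcw)
      (isRegularRing_quot_span_c_w uu e₀ y z hc hPr)
      (nonZeroDivisors.ne_zero (w_mem_nonZeroDivisors uu e₀)) h') hρ

end TChartUnit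

end TwoPlanesRung

end Summit.ResolutionOfSingularities.ResolutionOfSingularities.Theorems

end
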